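import Mathlib
import Literature.Computability.AlgebraicComplexity.LRPencilOfMatrix
import Summits.ValiantsHypothesis.ValiantsHypothesis.Theorems.GrenetZeonTwoDimCoefficientsDefs

/-!
# Crux `GrenetZeon.TwoDimCoefficients` (stmt-ValiantsHypothesis-8062), stub `stub_dualUnipotent`:
# normal form `B(0) = 0` for unipotent dual representations

In a unipotent dual representation `per_n = α·det A + β·tr(adj A · B)` (`A, B` affine, `det A ≡ c ≠ 0`)
one may assume `B(0) = 0`: replace `B` by `B − A·T` with the constant matrix `T = A(0)⁻¹ B(0)`; since
`tr(adj A · A · T) = det A · tr T = c·tr T` is a constant, only `α` changes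
(`dualUnipotentRepr_normalForm`).  In the normal form `A = A₀(1 + N(x))`, `B = A₀ M(x)` with `N, M`
LINEAR, the representation reads `per_n = α c + β c · Σ_{j<m} (−1)^j tr(N^j M)`, and homogeneity of
`per_n` (degree `n ≥ 3`) gives the identities `tr(N(x)^j M(x)) ≡ 0` for `j ≠ n − 1` (memo
`Cruxes/TwoDimCoefficients/CALIBRATION-stub_dualUnipotent.md` v4, N2; the top identity N4 is typed in
8062-p1 g2's `exists_nilpotent_pencil_of_dualUnipotentRepr`, `…DualUnipotentNormalForm.lean`) — this file
records only the affine-level normalisation `B(0) = 0` that keeps the whole representation (all degrees),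
which the low-degree cancellation identities need.

HONEST FRAMING: a WLOG for an open stub of an ASIDE item; `VP ≠ VNP` is not moved.
-/

set_option linter.dupNamespace false

noncomputable section

namespace Summit.ValiantsHypothesis.ValiantsHypothesis.Cruxes.TwoDimCoefficients.DimTwoCases

open MvPolynomial Matrix
open Literature.Computability.AlgebraicComplexity

variable {n m : ℕ}

/-- Entries of `A · T` (`T` constant) are affine when `A` is. [folklore] -/
theorem isAffine_mul_map_C (A : AffMat n m) (hA : IsAffine A) (T : Matrix (Fin m) (Fin m) ℂ) :
    IsAffine (A * T.map C) := by
  intro i j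
  rw [Matrix.mul_apply]
  refine (totalDegree_finsetSum _ _).trans (Finset.sup_le fun k _ => ?_)
  rw [Matrix.map_apply]
  refine (totalDegree_mul _ _).trans ?_
  rw [totalDegree_C, add_zero]
  exact hA i k

/-- **Normal form `B(0) = 0`.** A unipotent dual representation of `per_n` can be renormalised so that
the direction matrix `B` vanishes at the origin (`B ↦ B − A·A(0)⁻¹B(0)`, `α ↦ α + β·tr(A(0)⁻¹B(0))`).
[folklore] -/
theorem dualUnipotentRepr_normalForm (h : DualUnipotentRepr n m) :
    ∃ (α β c : ℂ) (A B : AffMat n m), IsAffine A ∧ IsAffine B ∧ c ≠ 0 ∧ A.det = C c ∧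
      constPart B = 0 ∧
      perPoly (Fin n) ℂ = C α * A.det + C β * (A.adjugate * B).trace := by
  obtain ⟨α, β, c, A, B, hA, hB, hc, hdet, hper⟩ := h
  set T : Matrix (Fin m) (Fin m) ℂ := (constPart A)⁻¹ * constPart B with hT
  have hA₀ : IsUnit (constPart A).det := by
    rw [det_constPart, hdet, constantCoeff_C]; exact hc.isUnit
  refine ⟨α + β * T.trace, β, c, A, B - A * T.map C, hA, ?_, hc, hdet, ?_, ?_⟩
  · -- affine
    intro i j
    rw [Matrix.sub_apply]
    refine (totalDegree_sub _ _).trans (max_le (hB i j) (isAffine_mul_map_C A hA T i j))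
  · -- `B'(0) = 0`
    have h1 : constPart (B - A * T.map C) = constPart B - constPart A * T := by
      ext i j
      simp only [constPart_apply, Matrix.sub_apply, map_sub, Matrix.mul_apply, map_sum, map_mul,
        Matrix.map_apply, constantCoeff_C]
    rw [h1, hT, Matrix.mul_nonsing_inv_cancel_left _ _ hA₀, sub_self]
  · -- the identity
    have htr : (A.adjugate * (B - A * T.map C)).trace =
        (A.adjugate * B).trace - C c * C T.trace := by
      rw [Matrix.mul_sub, Matrix.trace_sub, ← Matrix.mul_assoc, Matrix.adjugate_mul, hdet,
        Matrix.smul_mul, Matrix.one_mul, Matrix.trace_smul, smul_eq_mul]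
      congr 2
      -- `tr (T.map C) = C (tr T)`
      simp only [Matrix.trace, Matrix.diag_apply, Matrix.map_apply, map_sum]
    rw [htr, hper, hdet]
    simp only [map_add, map_mul]
    ring

end Summit.ValiantsHypothesis.ValiantsHypothesis.Cruxes.TwoDimCoefficients.DimTwoCases

end
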